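import Summits.AtomisticToContinuum.BoseEinsteinCondensation.Theses.BECHardSphereReduction
import Literature.MathematicalPhysics.QuantumManyBody.BoseGasThermodynamicLimitRuelle

/-!
# BECHardSphereReduction / HardSphereZeroMode — the near-minimiser condition is not vacuous

Route `route-AtomisticToContinuum-BECHardSphereReduction`, support item `HardSphereZeroMode`
(stmt-AtomisticToContinuum-11888). The item asks, eventually in `N` and for some slack `δ > 0`, a
property of every trial state `Ψ` with `energy HS₁ Ψ ≤ E₀(HS₁, N, L_N(η)) + δ` in the Dirichlet box
of side `L_N(η) = (N/η)^{1/3}`, `HS₁ = ⊤·1_{[0,1]}` the unit hard-sphere potential. We record that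
in the dilute regime this hypothesis is satisfiable and selects genuine near-minimisers: for
`0 < η < 1/8` the hard-sphere ground-state energy `E₀(HS₁, N, L_N(η))` is finite for all large `N`
(Ruelle's low-density finiteness `e⁺(η) < ∞` for `η (1+R)³ < 1`, range `R = 1`), so for every
`δ > 0` the set of `δ`-near-minimisers is nonempty and is not the whole trial class.

* `hardSphere_range_one` — `HS₁ r = 0` for `r > 1`;
* `eventually_groundStateEnergy_hardSphere_lt_top` — `∀ᶠ N, E₀(HS₁, N, L_N(η)) < ⊤` for
  `0 < η < 1/8`;
* `eventually_exists_nearMinimiser_hardSphere` — hence for all large `N` and every `δ > 0` some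
  trial state has `energy HS₁ Ψ ≤ E₀ + δ` (the hypothesis of `HardSphereZeroMode` is met);
* `hardSphereZeroMode_of_dilute` — the reduction: it suffices to prove the item below any threshold
  `η₀`, assuming at each large `N` that `E₀ < ⊤` and that near-minimisers exist at every slack.
-/

noncomputable section

namespace Summit.AtomisticToContinuum.BoseEinsteinCondensation.Theorems

open MeasureTheory ENNReal Filter Literature.MathematicalPhysics.QuantumManyBody.BoseGas

/-- The unit hard-sphere potential `HS₁ = ⊤·1_{[0,1]}` has range `1`. [folklore] -/
theorem hardSphere_range_one (r : ℝ) (hr : 1 < r) :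
    Set.indicator (Set.Iic 1) (fun _ : ℝ => (⊤ : ℝ≥0∞)) r = 0 :=
  Set.indicator_of_notMem (by simpa using hr) _

/-- The unit hard-sphere potential is measurable. [folklore] -/
theorem measurable_hardSphere :
    Measurable (Set.indicator (Set.Iic 1) (fun _ : ℝ => (⊤ : ℝ≥0∞))) :=
  measurable_const.indicator measurableSet_Iic

/-- **Dilute hard spheres have finite Dirichlet ground-state energy along the thermodynamic
sequence**: for `0 < η < 1/8`, `E₀(HS₁, N, L_N(η)) < ⊤` for all large `N` (Ruelle's finiteness of
the upper energy per particle at `η (1 + 1)³ < 1`). [cite: Ruelle1969, §3.5.11] -/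
theorem eventually_groundStateEnergy_hardSphere_lt_top {η : ℝ} (hη : 0 < η) (hη8 : η < 1 / 8) :
    ∀ᶠ N : ℕ in atTop, groundStateEnergy (Set.indicator (Set.Iic 1) (fun _ : ℝ => (⊤ : ℝ≥0∞))) N
      (sideLength η N) < ⊤ := by
  have hfin : limsupEnergyPerParticle (Set.indicator (Set.Iic 1) (fun _ : ℝ => (⊤ : ℝ≥0∞))) η < ⊤ :=
    limsup_lt_top_of_small measurable_hardSphere hardSphere_range_one one_pos hη (by nlinarith)
  have hev : ∀ᶠ N : ℕ in atTop,
      energyPerParticleDirichlet (Set.indicator (Set.Iic 1) (fun _ : ℝ => (⊤ : ℝ≥0∞))) η N < ⊤ :=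
    Filter.eventually_lt_of_limsup_lt hfin
  filter_upwards [hev, eventually_gt_atTop 0] with N hN hN0
  rw [energyPerParticleDirichlet] at hN
  have hNtop : ((N : ℕ) : ℝ≥0∞) ≠ ⊤ := ENNReal.natCast_ne_top N
  have h := ENNReal.mul_lt_top hN hNtop.lt_top
  rwa [ENNReal.div_mul_cancel (Nat.cast_ne_zero.2 hN0.ne') hNtop] at h

/-- **The hypothesis of `HardSphereZeroMode` is met**: for `0 < η < 1/8`, all large `N` and every
slack `δ > 0`, some admissible trial state in the box of side `L_N(η)` has unit-hard-sphere energy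
at most `E₀ + δ`. [folklore] -/
theorem eventually_exists_nearMinimiser_hardSphere {η : ℝ} (hη : 0 < η) (hη8 : η < 1 / 8) :
    ∀ᶠ N : ℕ in atTop, ∀ δ : ℝ≥0∞, 0 < δ →
      ∃ Ψ : TrialState N (sideLength η N),
        energy (Set.indicator (Set.Iic 1) (fun _ : ℝ => (⊤ : ℝ≥0∞))) Ψ ≤
          groundStateEnergy (Set.indicator (Set.Iic 1) (fun _ : ℝ => (⊤ : ℝ≥0∞))) N
            (sideLength η N) + δ := by
  filter_upwards [eventually_groundStateEnergy_hardSphere_lt_top hη hη8] with N hN δ hδ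
  have hlt : groundStateEnergy (Set.indicator (Set.Iic 1) (fun _ : ℝ => (⊤ : ℝ≥0∞))) N
      (sideLength η N) <
      groundStateEnergy (Set.indicator (Set.Iic 1) (fun _ : ℝ => (⊤ : ℝ≥0∞))) N
        (sideLength η N) + δ :=
    ENNReal.lt_add_right hN.ne hδ.ne'
  rw [groundStateEnergy, iInf_lt_iff] at hlt
  obtain ⟨Ψ, hΨ⟩ := hlt
  exact ⟨Ψ, hΨ.le⟩

/-- **Reduction to the dilute, finite-energy case.** To prove `HardSphereZeroMode` it suffices to
treat reduced densities below any fixed threshold `η₀ > 0`, and there one may assume, at each large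
`N`, that `E₀(HS₁, N, L_N(η)) < ⊤` and that `δ`-near-minimisers exist for every `δ > 0` (both hold
eventually once `η < 1/8`; the threshold of the conclusion is `min η₀ (1/8)`). [folklore] -/
theorem hardSphereZeroMode_of_dilute
    (h : ∃ η₀ : ℝ, 0 < η₀ ∧ ∀ η : ℝ, 0 < η → η < η₀ → ∃ c : ℝ, 0 < c ∧ ∀ᶠ N : ℕ in atTop,
      groundStateEnergy (Set.indicator (Set.Iic 1) (fun _ : ℝ => (⊤ : ℝ≥0∞))) N (sideLength η N)
          < ⊤ →
      (∀ δ : ℝ≥0∞, 0 < δ → ∃ Ψ : TrialState N (sideLength η N),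
        energy (Set.indicator (Set.Iic 1) (fun _ : ℝ => (⊤ : ℝ≥0∞))) Ψ ≤
          groundStateEnergy (Set.indicator (Set.Iic 1) (fun _ : ℝ => (⊤ : ℝ≥0∞))) N
            (sideLength η N) + δ) →
      ∃ δ : ℝ≥0∞, 0 < δ ∧ ∀ Ψ : TrialState N (sideLength η N),
        energy (Set.indicator (Set.Iic 1) (fun _ : ℝ => (⊤ : ℝ≥0∞))) Ψ ≤
          groundStateEnergy (Set.indicator (Set.Iic 1) (fun _ : ℝ => (⊤ : ℝ≥0∞))) N
            (sideLength η N) + δ →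
        ENNReal.ofReal (c * N) ≤ occupation N ((box (sideLength η N)).indicator
          fun _ => ((Real.sqrt (sideLength η N ^ 3))⁻¹ : ℂ)) Ψ.ψ) :
    Summit.AtomisticToContinuum.BoseEinsteinCondensation.Theses.BECHardSphereReduction.HardSphereZeroMode := by
  obtain ⟨η₀, hη₀, h⟩ := h
  refine ⟨min η₀ (1 / 8), lt_min hη₀ (by norm_num), fun η hη hηlt => ?_⟩
  have hη₀' : η < η₀ := hηlt.trans_le (min_le_left _ _)
  have hη8 : η < 1 / 8 := hηlt.trans_le (min_le_right _ _)
  obtain ⟨c, hc, hev⟩ := h η hη hη₀'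
  refine ⟨c, hc, ?_⟩
  filter_upwards [hev, eventually_groundStateEnergy_hardSphere_lt_top hη hη8,
    eventually_exists_nearMinimiser_hardSphere hη hη8] with N h1 h2 h3
  exact h1 h2 h3

end Summit.AtomisticToContinuum.BoseEinsteinCondensation.Theorems

end
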